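import Mathlib
import Literature.Analysis.InnerProduct.KahanEigenvaluePairing

/-!
# Venture YMGap, track Y3 FLOW-DATA — the index-wise eigenvalue RADIUS of lineage B's block certificates

HONEST FRAMING: venture file of the cell `pub-ymgap` (QuantumFields programme), track Y3, lineage B
("B-kstm").  It types the LAST untyped link of lineage B's certificate chain — the theorem behind the
`delta` that the C program `kscert.c` / `certeig.c` attaches to every symmetry block — as a statement about
finite matrices.  No lattice object, no number, no row, nothing about limits or a mass gap; the floating
point bookkeeping of the program (directed rounding of the four residuals) is NOT modelled: the four
residual bounds are HYPOTHESES here, exactly as the program prints them.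

THE PROGRAM'S CERTIFICATE (header of `certeig.c`, verbatim up to notation).  `S` = the exact real symmetric
block, `A` = the floating-point symmetric matrix actually diagonalised, `X` = the computed eigenvector
matrix, `L` = the computed eigenvalues; the program bounds, with sums in `FE_UPWARD`,
`ε ≥ ‖Xᵀ X − 1‖_F`, `E1 ≥ ‖A X − X·diag L‖_F`, `E0 ≥ ‖S − A‖_F`, `nS ≥ ‖S‖₂`, and sets
`δ := (E1 + E0·√(1 + ε)) + ε·(nS + max |L|)`, claiming "THEOREM (Weyl + polar factor `Q` of `X`,
`‖X − Q‖₂ ≤ ε` for `ε < 1`): `|λᵢ(S) − Lᵢ| ≤ δ` for every `i`, both sorted."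

WHAT IS TYPED (any `RCLike` scalar field, any finite index type; `λ↓` = Mathlib's descending enumeration
`Matrix.IsHermitian.eigenvalues₀`; `M = diag L`):
* `abs_eigenvalues₀_sub_le_kahanRadius` — from the three Frobenius hypotheses `Σ‖(S − A)ᵢⱼ‖² ≤ E0²`,
  `Σ‖(A X − X M)ᵢⱼ‖² ≤ E1²`, `Σ‖(Xᴴ X − 1)ᵢⱼ‖² ≤ ε²` with `0 ≤ ε < 1`:
  `|λ↓ᵢ(S) − λ↓ᵢ(M)| ≤ (E1 + E0·√(1 + ε)) / √(1 − ε)` for EVERY `i` — Kahan's theorem (tree: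
  `Literature.Analysis.InnerProduct.abs_eigenvalues₀_sub_eigenvalues₀_le_div`, Stewart–Sun Thm IV.5.4) with
  the non-unitary intertwiner `X` (`σ_min(X)² ≥ 1 − ε`) and the residual `S X − X M = (S − A) X + (A X − X M)`;
  NO polar factor and no hypothesis on `A` are needed;
* `abs_eigenvalues₀_sub_le_recordRadius` — the program's `δ` is ALSO a valid index-wise radius whenever
  `ε ≤ 1/2` and `E1 + E0·√(1 + ε) ≤ nS + max|L|` (pure arithmetic: `(1 − ε)^{-1/2} ≤ 1 + ε`): this is the
  statement the rows of record use, with a side condition that holds at every one of the 240 flux-sector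
  blocks of record via `E1 + E0√(1+ε) ≤ λ_top ≤ max|L|`, `nS ≥ 0` (factor ≥ 330 except the four diagonal-flux
  blocks on `4 × 4`, factor ≥ 1.3; `ε ≤ 1.1·10⁻¹⁰`; table in the cell's `flow/flow-eng-2/RADIUS-CHECK.md`);
* `ofFn_eigenvalues₀_diagonal` — `λ↓(diag L)` IS the list `L` sorted non-increasingly (the `eig_desc` column
  of the certificates), from Mathlib's `sort_roots_charpoly_eq_eigenvalues₀` and `charpoly_diagonal`;
* feeders `sum_norm_sq_mulVec_le` (`Σᵢ‖(R y)ᵢ‖² ≤ ‖R‖_F² Σ‖y‖²`), `norm_toEuclideanLin_le`,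
  `norm_sq_toEuclideanLin_bounds` (`(1 − ε)‖z‖² ≤ ‖X z‖² ≤ (1 + ε)‖z‖²` from `‖Xᴴ X − 1‖_F ≤ ε`).

Together with `KWeightTailTheorem` / `KWeightTailBlock` (kept-set tail, FR-18) this makes every lineage-B
eigenvalue row an instance of tree theorems modulo the program's interval arithmetic for `E0, E1, ε`.

References: G. W. Stewart, J.-G. Sun, *Matrix Perturbation Theory* (1990), Thm IV.5.4 [cite: StewartSun1990,
Thm IV.5.4]; W. Kahan, Proc. AMS 48 (1975) 11–17 [cite: Kahan1975]; the cell's `pub-ymgap-flow-eng-2/certeig.c`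
header (2026-08-22) and FLOW-REFEREE.md FR-18.
-/

noncomputable section

open Matrix WithLp
open scoped InnerProductSpace

namespace Summit.Ventures.YMGap.FlowData

namespace EigenRadius

variable {𝕜 : Type*} [RCLike 𝕜] {m : Type*} [Fintype m] [DecidableEq m]

/-! ### Feeders: Frobenius sums control Euclidean operator norms -/

omit [DecidableEq m] in
/-- **Row-wise Cauchy–Schwarz:** `Σᵢ ‖(R y)ᵢ‖² ≤ (Σᵢⱼ ‖Rᵢⱼ‖²) · Σⱼ ‖yⱼ‖²` (`‖R y‖ ≤ ‖R‖_F ‖y‖`). [folklore] -/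
theorem sum_norm_sq_mulVec_le (R : Matrix m m 𝕜) (y : m → 𝕜) :
    ∑ i, ‖(R *ᵥ y) i‖ ^ 2 ≤ (∑ i, ∑ j, ‖R i j‖ ^ 2) * ∑ j, ‖y j‖ ^ 2 := by
  rw [Finset.sum_mul]
  refine Finset.sum_le_sum fun i _ => ?_
  have h1 : ‖(R *ᵥ y) i‖ ≤ ∑ j, ‖R i j‖ * ‖y j‖ := by
    change ‖∑ j, R i j * y j‖ ≤ _
    exact (norm_sum_le _ _).trans (le_of_eq (Finset.sum_congr rfl fun j _ => norm_mul _ _))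
  calc ‖(R *ᵥ y) i‖ ^ 2 ≤ (∑ j, ‖R i j‖ * ‖y j‖) ^ 2 := pow_le_pow_left₀ (norm_nonneg _) h1 2
    _ ≤ (∑ j, ‖R i j‖ ^ 2) * ∑ j, ‖y j‖ ^ 2 := Finset.sum_mul_sq_le_sq_mul_sq _ _ _

/-- **`‖R z‖ ≤ F ‖z‖`** in `EuclideanSpace` whenever `Σᵢⱼ ‖Rᵢⱼ‖² ≤ F²`, `F ≥ 0`. [folklore] -/
theorem norm_toEuclideanLin_le (R : Matrix m m 𝕜) {F : ℝ} (hF : 0 ≤ F)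
    (hR : ∑ i, ∑ j, ‖R i j‖ ^ 2 ≤ F ^ 2) (z : EuclideanSpace 𝕜 m) :
    ‖toEuclideanLin R z‖ ≤ F * ‖z‖ := by
  refine (pow_le_pow_iff_left₀ (norm_nonneg _) (mul_nonneg hF (norm_nonneg _)) two_ne_zero).1 ?_
  have h1 : toEuclideanLin R z = toLp 2 (R *ᵥ ofLp z) := rfl
  rw [h1, EuclideanSpace.norm_sq_eq, mul_pow, EuclideanSpace.norm_sq_eq]
  exact (sum_norm_sq_mulVec_le R (ofLp z)).trans
    (mul_le_mul_of_nonneg_right hR (Finset.sum_nonneg fun _ _ => sq_nonneg _))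

/-- **Near-orthonormal columns.** If `Σᵢⱼ ‖(Xᴴ X − 1)ᵢⱼ‖² ≤ ε²` (`ε ≥ 0`) then
`(1 − ε) ‖z‖² ≤ ‖X z‖² ≤ (1 + ε) ‖z‖²` for every `z` (`‖X z‖² = ‖z‖² + re ⟪z, (Xᴴ X − 1) z⟫`). [folklore] -/
theorem norm_sq_toEuclideanLin_bounds (X : Matrix m m 𝕜) {ε : ℝ} (hε : 0 ≤ ε)
    (hG : ∑ i, ∑ j, ‖(Xᴴ * X - 1) i j‖ ^ 2 ≤ ε ^ 2) (z : EuclideanSpace 𝕜 m) :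
    (1 - ε) * ‖z‖ ^ 2 ≤ ‖toEuclideanLin X z‖ ^ 2 ∧
      ‖toEuclideanLin X z‖ ^ 2 ≤ (1 + ε) * ‖z‖ ^ 2 := by
  set D : Matrix m m 𝕜 := Xᴴ * X - 1 with hD
  have h1 : toEuclideanLin D z = toEuclideanLin Xᴴ (toEuclideanLin X z) - z := by
    have e1 : toEuclideanLin D z = toLp 2 (D *ᵥ ofLp z) := rfl
    have e2 : toEuclideanLin Xᴴ (toEuclideanLin X z) = toLp 2 (Xᴴ *ᵥ (X *ᵥ ofLp z)) := rfl
    have e3 : D *ᵥ ofLp z = Xᴴ *ᵥ (X *ᵥ ofLp z) - ofLp z := by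
      rw [hD, sub_mulVec, ← mulVec_mulVec, one_mulVec]
    rw [e1, e2, e3, toLp_sub, toLp_ofLp]
  have hkey : ‖toEuclideanLin X z‖ ^ 2 = ‖z‖ ^ 2 + RCLike.re ⟪z, toEuclideanLin D z⟫_𝕜 := by
    rw [h1, inner_sub_right, map_sub, Matrix.toEuclideanLin_conjTranspose_eq_adjoint,
      LinearMap.adjoint_inner_right, ← norm_sq_eq_re_inner, ← norm_sq_eq_re_inner]
    ring
  have hDz : ‖toEuclideanLin D z‖ ≤ ε * ‖z‖ := norm_toEuclideanLin_le D hε hG z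
  have hre : |RCLike.re ⟪z, toEuclideanLin D z⟫_𝕜| ≤ ε * ‖z‖ ^ 2 := by
    calc |RCLike.re ⟪z, toEuclideanLin D z⟫_𝕜| ≤ ‖⟪z, toEuclideanLin D z⟫_𝕜‖ := RCLike.abs_re_le_norm _
      _ ≤ ‖z‖ * ‖toEuclideanLin D z‖ := norm_inner_le_norm _ _
      _ ≤ ‖z‖ * (ε * ‖z‖) := mul_le_mul_of_nonneg_left hDz (norm_nonneg _)
      _ = ε * ‖z‖ ^ 2 := by ring
  rw [hkey]
  constructor
  · have := neg_abs_le (RCLike.re ⟪z, toEuclideanLin D z⟫_𝕜)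
    linarith
  · have := le_abs_self (RCLike.re ⟪z, toEuclideanLin D z⟫_𝕜)
    linarith

/-! ### The diagonal matrix of computed eigenvalues -/

omit [Fintype m] in
/-- `diag L` with real `L` is Hermitian over `𝕜`. [folklore] -/
theorem isHermitian_diagonal_ofReal (L : m → ℝ) :
    (diagonal fun j => ((L j : ℝ) : 𝕜)).IsHermitian :=
  isHermitian_diagonal_iff.2 fun _ => by
    rw [isSelfAdjoint_iff, RCLike.star_def, RCLike.conj_ofReal]

/-- **`λ↓(diag L)` is `L` sorted non-increasingly** — the `eig_desc` column of the certificates: the list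
`(λ↓₀, λ↓₁, …)` of Mathlib's descending eigenvalues of `diag L` is the multiset `{L j}` sorted by `≥`.
[folklore] -/
theorem ofFn_eigenvalues₀_diagonal (L : m → ℝ) :
    List.ofFn (isHermitian_diagonal_ofReal (𝕜 := 𝕜) L).eigenvalues₀ =
      ((Finset.univ.val.map L).sort (· ≥ ·)) := by
  have hr : (∏ i, (Polynomial.X - Polynomial.C ((L i : ℝ) : 𝕜))).roots =
      Finset.univ.val.map (fun i => ((L i : ℝ) : 𝕜)) := by
    have e : ∏ i, (Polynomial.X - Polynomial.C ((L i : ℝ) : 𝕜)) =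
        ((Finset.univ.val.map fun i => ((L i : ℝ) : 𝕜)).map fun a => Polynomial.X - Polynomial.C a).prod := by
      rw [Multiset.map_map, Finset.prod_eq_multiset_prod]
      rfl
    rw [e, Polynomial.roots_multiset_prod_X_sub_C]
  rw [← Matrix.IsHermitian.sort_roots_charpoly_eq_eigenvalues₀, charpoly_diagonal, hr, Multiset.map_map]
  congr 2
  funext j
  simp

/-! ### The index-wise radius theorems -/

/-- **Index-wise eigenvalue radius of a block certificate (Kahan form).** Let `S` be Hermitian (the exact
block), `A` ANY matrix (the floating-point matrix that was diagonalised), `X` ANY matrix (computed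
eigenvectors), `L` real (computed eigenvalues), and suppose the three Frobenius residuals are bounded:
`Σ‖(S − A)ᵢⱼ‖² ≤ E0²`, `Σ‖(A X − X·diag L)ᵢⱼ‖² ≤ E1²`, `Σ‖(Xᴴ X − 1)ᵢⱼ‖² ≤ ε²` with `0 ≤ ε < 1`,
`E0, E1 ≥ 0`. Then for EVERY index `i` the `i`-th largest eigenvalue of `S` is within
`(E1 + E0·√(1 + ε)) / √(1 − ε)` of the `i`-th largest entry of `L`.  (Kahan's theorem with the intertwiner
`X`, `σ_min(X)² ≥ 1 − ε`, and `‖S X − X·diag L‖ ≤ E0‖X‖ + E1 ≤ E0√(1+ε) + E1`.)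
[cite: StewartSun1990, Thm IV.5.4] -/
theorem abs_eigenvalues₀_sub_le_kahanRadius {S A X : Matrix m m 𝕜} (hS : S.IsHermitian) (L : m → ℝ)
    {E0 E1 ε : ℝ} (hE0 : 0 ≤ E0) (hE1 : 0 ≤ E1) (hε0 : 0 ≤ ε) (hε1 : ε < 1)
    (h0 : ∑ i, ∑ j, ‖(S - A) i j‖ ^ 2 ≤ E0 ^ 2)
    (h1 : ∑ i, ∑ j, ‖(A * X - X * diagonal (fun j => ((L j : ℝ) : 𝕜))) i j‖ ^ 2 ≤ E1 ^ 2)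
    (hG : ∑ i, ∑ j, ‖(Xᴴ * X - 1) i j‖ ^ 2 ≤ ε ^ 2) (i : Fin (Fintype.card m)) :
    |hS.eigenvalues₀ i - (isHermitian_diagonal_ofReal (𝕜 := 𝕜) L).eigenvalues₀ i| ≤
      (E1 + E0 * √(1 + ε)) / √(1 - ε) := by
  set M : Matrix m m 𝕜 := diagonal (fun j => ((L j : ℝ) : 𝕜)) with hM
  have h1ε : 0 < 1 - ε := by linarith
  have hs : 0 < √(1 - ε) := Real.sqrt_pos.2 h1ε
  have hK0 : 0 ≤ E1 + E0 * √(1 + ε) := by positivity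
  -- lower singular value bound of `X`, in coordinates
  have hX : ∀ y : m → 𝕜, √(1 - ε) ^ 2 * ∑ j, ‖y j‖ ^ 2 ≤ ∑ i, ‖(X *ᵥ y) i‖ ^ 2 := by
    intro y
    have hb := (norm_sq_toEuclideanLin_bounds X hε0 hG (toLp 2 y)).1
    have e1 : toEuclideanLin X (toLp 2 y) = toLp 2 (X *ᵥ y) := rfl
    rw [Real.sq_sqrt h1ε.le]
    rw [e1, EuclideanSpace.norm_sq_eq, EuclideanSpace.norm_sq_eq] at hb
    exact hb
  -- residual bound of `S X − X M`, in coordinates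
  have hres : ∀ y : m → 𝕜, ∑ i, ‖((S * X - X * M) *ᵥ y) i‖ ^ 2 ≤
      (E1 + E0 * √(1 + ε)) ^ 2 * ∑ j, ‖y j‖ ^ 2 := by
    intro y
    set z : EuclideanSpace 𝕜 m := toLp 2 y with hz
    have hXz : ‖toEuclideanLin X z‖ ≤ √(1 + ε) * ‖z‖ := by
      refine (pow_le_pow_iff_left₀ (norm_nonneg _) (by positivity) two_ne_zero).1 ?_
      rw [mul_pow, Real.sq_sqrt (by linarith)]
      exact (norm_sq_toEuclideanLin_bounds X hε0 hG z).2
    have hdec : toEuclideanLin (S * X - X * M) z =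
        toEuclideanLin (S - A) (toEuclideanLin X z) + toEuclideanLin (A * X - X * M) z := by
      have e0 : S * X - X * M = (S - A) * X + (A * X - X * M) := by rw [sub_mul]; abel
      have e1 : toEuclideanLin (S * X - X * M) z = toLp 2 ((S * X - X * M) *ᵥ y) := rfl
      have e2 : toEuclideanLin (S - A) (toEuclideanLin X z) = toLp 2 ((S - A) *ᵥ (X *ᵥ y)) := rfl
      have e3 : toEuclideanLin (A * X - X * M) z = toLp 2 ((A * X - X * M) *ᵥ y) := rfl
      rw [e1, e2, e3, e0, add_mulVec, ← mulVec_mulVec, toLp_add]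
    have hnorm : ‖toEuclideanLin (S * X - X * M) z‖ ≤ (E1 + E0 * √(1 + ε)) * ‖z‖ := by
      rw [hdec]
      calc ‖toEuclideanLin (S - A) (toEuclideanLin X z) + toEuclideanLin (A * X - X * M) z‖
          ≤ ‖toEuclideanLin (S - A) (toEuclideanLin X z)‖ + ‖toEuclideanLin (A * X - X * M) z‖ :=
            norm_add_le _ _
        _ ≤ E0 * ‖toEuclideanLin X z‖ + E1 * ‖z‖ :=
            add_le_add (norm_toEuclideanLin_le _ hE0 h0 _) (norm_toEuclideanLin_le _ hE1 h1 _)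
        _ ≤ E0 * (√(1 + ε) * ‖z‖) + E1 * ‖z‖ := by gcongr
        _ = (E1 + E0 * √(1 + ε)) * ‖z‖ := by ring
    have hsq := pow_le_pow_left₀ (norm_nonneg _) hnorm 2
    have e1 : toEuclideanLin (S * X - X * M) z = toLp 2 ((S * X - X * M) *ᵥ y) := rfl
    rw [e1, mul_pow, EuclideanSpace.norm_sq_eq, hz, EuclideanSpace.norm_sq_eq] at hsq
    exact hsq
  exact Literature.Analysis.InnerProduct.abs_eigenvalues₀_sub_eigenvalues₀_le_div hS X
    (isHermitian_diagonal_ofReal (𝕜 := 𝕜) L) hs hK0 hX hres i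

/-- Pure arithmetic behind the comparison with the program's radius: for `0 ≤ ε ≤ 1/2` and `0 ≤ a ≤ B`,
`a / √(1 − ε) ≤ a + ε·B` (because `(1 − ε)^{-1/2} ≤ 1 + ε` on `[0, (√5 − 1)/2]`). [folklore] -/
theorem div_sqrt_one_sub_le {a B ε : ℝ} (ha : 0 ≤ a) (haB : a ≤ B) (hε0 : 0 ≤ ε) (hε : ε ≤ 1 / 2) :
    a / √(1 - ε) ≤ a + ε * B := by
  have h1ε : 0 < 1 - ε := by linarith
  have hs : 0 < √(1 - ε) := Real.sqrt_pos.2 h1ε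
  -- `1 ≤ (1 + ε) √(1 − ε)` since `1 ≤ (1 + ε)² (1 − ε)` for `ε ≤ 1/2`
  have hkey : 1 ≤ (1 + ε) * √(1 - ε) := by
    have h2a : 0 ≤ 1 - ε - ε ^ 2 := by nlinarith
    have h2 : (1 : ℝ) ≤ (1 + ε) ^ 2 * (1 - ε) := by nlinarith [mul_nonneg hε0 h2a]
    have h3 : √((1 + ε) ^ 2 * (1 - ε)) = (1 + ε) * √(1 - ε) := by
      rw [Real.sqrt_mul (sq_nonneg _), Real.sqrt_sq (by linarith)]
    calc (1 : ℝ) = √1 := Real.sqrt_one.symm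
      _ ≤ √((1 + ε) ^ 2 * (1 - ε)) := Real.sqrt_le_sqrt h2
      _ = (1 + ε) * √(1 - ε) := h3
  rw [div_le_iff₀ hs]
  -- `a ≤ a (1 + ε) √(1 − ε) ≤ (a + ε B) √(1 − ε)`
  have h4 : a ≤ a * ((1 + ε) * √(1 - ε)) := le_mul_of_one_le_right ha hkey
  have h5 : a * ((1 + ε) * √(1 - ε)) = (a + ε * a) * √(1 - ε) := by ring
  have h6 : (a + ε * a) * √(1 - ε) ≤ (a + ε * B) * √(1 - ε) := by gcongr
  linarith

/-- **The radius of record.** Under the hypotheses of `abs_eigenvalues₀_sub_le_kahanRadius` and additionally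
`ε ≤ 1/2` and `E1 + E0·√(1 + ε) ≤ nS + Lmax` (any reals `nS, Lmax`; in the program `nS ≥ ‖S‖₂ ≥ 0` and
`Lmax = max |L| ≥` the top computed eigenvalue, so the side condition holds whenever the residuals are
below the top eigenvalue), the program's radius `δ = (E1 + E0·√(1 + ε)) + ε·(nS + Lmax)` encloses
index-wise: `|λ↓ᵢ(S) − λ↓ᵢ(diag L)| ≤ δ` for every `i`. [cite: StewartSun1990, Thm IV.5.4] -/
theorem abs_eigenvalues₀_sub_le_recordRadius {S A X : Matrix m m 𝕜} (hS : S.IsHermitian) (L : m → ℝ)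
    {E0 E1 ε nS Lmax : ℝ} (hE0 : 0 ≤ E0) (hE1 : 0 ≤ E1) (hε0 : 0 ≤ ε) (hε : ε ≤ 1 / 2)
    (h0 : ∑ i, ∑ j, ‖(S - A) i j‖ ^ 2 ≤ E0 ^ 2)
    (h1 : ∑ i, ∑ j, ‖(A * X - X * diagonal (fun j => ((L j : ℝ) : 𝕜))) i j‖ ^ 2 ≤ E1 ^ 2)
    (hG : ∑ i, ∑ j, ‖(Xᴴ * X - 1) i j‖ ^ 2 ≤ ε ^ 2)
    (hside : E1 + E0 * √(1 + ε) ≤ nS + Lmax) (i : Fin (Fintype.card m)) :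
    |hS.eigenvalues₀ i - (isHermitian_diagonal_ofReal (𝕜 := 𝕜) L).eigenvalues₀ i| ≤
      (E1 + E0 * √(1 + ε)) + ε * (nS + Lmax) :=
  (abs_eigenvalues₀_sub_le_kahanRadius hS L hE0 hE1 hε0 (by linarith) h0 h1 hG i).trans
    (div_sqrt_one_sub_le (by positivity) hside hε0 hε)

/-- **Row form.** Same hypotheses as `abs_eigenvalues₀_sub_le_recordRadius`: the `i`-th largest eigenvalue
of the exact block lies in `[λ↓ᵢ(diag L) − δ, λ↓ᵢ(diag L) + δ]` — the interval a lineage-B row quotes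
(before the kept-set tail of `KWeightTailTheorem` is added on the right). [cite: StewartSun1990, Thm IV.5.4] -/
theorem eigenvalues₀_mem_Icc_recordRadius {S A X : Matrix m m 𝕜} (hS : S.IsHermitian) (L : m → ℝ)
    {E0 E1 ε nS Lmax : ℝ} (hE0 : 0 ≤ E0) (hE1 : 0 ≤ E1) (hε0 : 0 ≤ ε) (hε : ε ≤ 1 / 2)
    (h0 : ∑ i, ∑ j, ‖(S - A) i j‖ ^ 2 ≤ E0 ^ 2)
    (h1 : ∑ i, ∑ j, ‖(A * X - X * diagonal (fun j => ((L j : ℝ) : 𝕜))) i j‖ ^ 2 ≤ E1 ^ 2)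
    (hG : ∑ i, ∑ j, ‖(Xᴴ * X - 1) i j‖ ^ 2 ≤ ε ^ 2)
    (hside : E1 + E0 * √(1 + ε) ≤ nS + Lmax) (i : Fin (Fintype.card m)) :
    hS.eigenvalues₀ i ∈ Set.Icc
      ((isHermitian_diagonal_ofReal (𝕜 := 𝕜) L).eigenvalues₀ i - ((E1 + E0 * √(1 + ε)) + ε * (nS + Lmax)))
      ((isHermitian_diagonal_ofReal (𝕜 := 𝕜) L).eigenvalues₀ i + ((E1 + E0 * √(1 + ε)) + ε * (nS + Lmax))) := by
  have h := abs_eigenvalues₀_sub_le_recordRadius hS L hE0 hE1 hε0 hε h0 h1 hG hside i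
  rw [abs_sub_le_iff] at h
  constructor <;> linarith [h.1, h.2]

end EigenRadius

end Summit.Ventures.YMGap.FlowData
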